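import Summits.Ventures.CertifiedManyBodySolver.Observables.BraggWeightPeriodicPattern
import HarnessLib

/-!
# Periodic patterns, II: lattice symmetries and the D₄ orbit mean of a pattern autocorrelation

HONEST FRAMING: first certified bounds; not a superconductivity verdict; every number certified or labelled float.

Speedrun `mbsolver`, seat sr-mbsolver-lit-1 (literature team), gen 12.  Pure harmonic analysis on the discrete
torus; zero compute; no state, no certificate, no named fact, no number of record.  Companion of
`Observables/BraggWeightPeriodicPattern.lean` (autocorrelation of a periodic pattern = trigonometric series on the
dual grid with weights `|f̂(k)|²`).  The certified per-arm stripe ceilings (`Observables/BraggWeightSymmetry.lean`,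
`chargeArm_braggWeight_le_r262` …) are stated for D₄-INVARIANT correlation functions (the orbit mean over the
point group of the square lattice); this file computes what the orbit mean does to a pattern autocorrelation:
it averages the WEIGHTS over the orbit of the wavevector, so every representing measure has Bragg weight
`8⁻¹ Σ_{g ∈ D₄} |f̂(g k)|²` at `dualVec k` — for a unidirectional (`y`-independent) REAL stripe profile this is
`|f̂(k)|² / 2` per arm, the factor of `HOME/lit/stripe_print_comparator_D2.md` §1 in full generality (any period,
any profile; `BraggWeightAtomic.lean` §5 was the single-harmonic case).

## Content

* `dualSeries w r = Σ_k w(k) χ_k(toTorus r)` — trigonometric series on the dual grid with real weights (`d`, `L`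
  arbitrary); `autocorr_eq_dualSeries`; `dualSeries_eq_trigPoly`; **`braggWeight_of_represents_dualSeries`**: for
  nonnegative weights every finite representing measure has Bragg weight `w k` at `dualVec k`.
* Lattice symmetries (general `d`): `dualSeries_comp_perm` (coordinate permutations) and `dualSeries_update_neg`
  (coordinate reflections) move from the lattice argument to the weights.
* `d = 2`: `sum8` (the eight signed coordinate maps of D₄, written out as in `BraggWeightAtomic.orbitMean_stripeX_trigPoly`
  and `Transport/D4VecAction.lean` §1), `orbitMean8 C = 8⁻¹ · sum8 C`, `orbitWt8 w = 8⁻¹ · sum8 w`;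
  **`orbitMean8_dualSeries : orbitMean8 (dualSeries w) = dualSeries (orbitWt8 w)`**;
  **`braggWeight_of_represents_orbitMean`**: Bragg weight of any measure representing the orbit mean of a pattern
  autocorrelation at `dualVec k` = `orbitWt8 (|f̂|²) k`.
* Unidirectional patterns: `torusFourier_mul_of_shift_covariant` / `fourierCoeff_eq_zero_of_shift_covariant`
  (a pattern with `f (x + e₁) = c · f x` has `f̂(k) = 0` wherever `c · conj e(k₁) ≠ 1`), the two cases
  `fourierCoeff_eq_zero_of_shift_invariant` (`c = 1`: support on `k₁ = 0`) and `fourierCoeff_eq_zero_of_antiphase`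
  (`c = −1`, period 16: support on `k₁ = 8`), `norm_fourierCoeff_neg` (real patterns: `|f̂(−k)| = |f̂(k)|`), and
  the two M3 readings **`braggWeight_chargeArm_of_represents_orbitMean_xStripe : braggWeight μ ![(π/4, 0)] =
  |f̂(1, 0)|² / 2`** (orbit mean of ANY real `y`-independent 8-periodic pattern) and
  **`braggWeight_spinArm_of_represents_orbitMean_antiphaseStripe : braggWeight μ ![(7π/8, π)] = |f̂(7, 8)|² / 2`**
  (orbit mean of ANY real 16-periodic pattern antiphase in `y`) — 'per-arm = half the squared harmonic'.

## Not here

Nothing about a Hubbard state, a row or a certificate; no numerical `|f̂|²`.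
-/

noncomputable section

namespace Summit.Ventures.CertifiedManyBodySolver.Observables

open MeasureTheory Complex Filter Topology Finset ZMod
open Literature.Probability.LatticeModels
open scoped Real BigOperators NNReal ENNReal ComplexConjugate

variable {d L : ℕ} [NeZero L]

/-! ### §1. Trigonometric series on the dual grid with arbitrary real weights -/

/-- `dualSeries w r = Σ_k w(k) χ_k(toTorus r)`: a trigonometric series on `ℤᵈ` with atoms on the dual grid of the
`L`-torus and real weights `w`. -/
def dualSeries (w : TorusSite d L → ℝ) (r : Fin d → ℤ) : ℂ := ∑ k, (w k : ℂ) * torusChar k (toTorus L r)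

/-- The autocorrelation of a pattern is the dual series with weights `|f̂(k)|²`. -/
theorem autocorr_eq_dualSeries (f : TorusSite d L → ℂ) (r : Fin d → ℤ) :
    autocorr f (toTorus L r) = dualSeries (fun k => ‖fourierCoeff f k‖ ^ 2) r := by
  rw [autocorr_eq_sum_fourierCoeff, dualSeries]

/-- A dual series with nonnegative weights is the `trigPoly` of `BraggWeightAtomic.lean` along `Fintype.equivFin`. -/
theorem dualSeries_eq_trigPoly (w : TorusSite d L → ℝ≥0) (r : Fin d → ℤ) :
    dualSeries (fun k => (w k : ℝ)) r
      = trigPoly (patternVec d L) (fun l => w ((Fintype.equivFin (TorusSite d L)).symm l)) r := by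
  rw [dualSeries, trigPoly, ← (Fintype.equivFin (TorusSite d L)).symm.sum_comp]
  refine Finset.sum_congr rfl fun l _ => ?_
  rw [show patternVec d L l = dualVec ((Fintype.equivFin (TorusSite d L)).symm l) from rfl,
    exp_dualVec_eq_torusChar]

/-- **Bragg weights of a dual series.**  For nonnegative weights, EVERY finite measure representing
`dualSeries w` has Bragg weight exactly `w k` at the dual-grid wavevector `dualVec k`. -/
theorem braggWeight_of_represents_dualSeries (w : TorusSite d L → ℝ) (hw : ∀ k, 0 ≤ w k)
    (μ : Measure (EuclideanSpace ℝ (Fin d))) [IsFiniteMeasure μ]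
    (hμ : ∀ r : Fin d → ℤ, ∫ ξ, exp ((∑ i, (r i : ℝ) * ξ i : ℝ) * I) ∂μ = dualSeries w r)
    (k : TorusSite d L) : braggWeight μ ![dualVec k] = w k := by
  set w' : TorusSite d L → ℝ≥0 := fun k => ⟨w k, hw k⟩ with hw'
  have hww : (fun k => (w' k : ℝ)) = w := funext fun k => rfl
  have hμ' : ∀ r : Fin d → ℤ, ∫ ξ, exp ((∑ i, (r i : ℝ) * ξ i : ℝ) * I) ∂μ
      = trigPoly (patternVec d L) (fun l => w' ((Fintype.equivFin (TorusSite d L)).symm l)) r := fun r => by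
    rw [hμ r, ← dualSeries_eq_trigPoly, hww]
  have h := braggWeight_eq_of_represents_trigPoly μ hμ' patternVec_mem_Ioc patternVec_injective
    (Fintype.equivFin (TorusSite d L) k)
  rw [patternVec_equivFin, Equiv.symm_apply_apply] at h
  exact h

/-- Off the dual grid a dual series carries no Bragg weight. -/
theorem braggWeight_eq_zero_of_represents_dualSeries (w : TorusSite d L → ℝ) (hw : ∀ k, 0 ≤ w k)
    (μ : Measure (EuclideanSpace ℝ (Fin d))) [IsFiniteMeasure μ]
    (hμ : ∀ r : Fin d → ℤ, ∫ ξ, exp ((∑ i, (r i : ℝ) * ξ i : ℝ) * I) ∂μ = dualSeries w r)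
    {Q : Fin d → ℝ} (hQ : ∀ i, Q i ∈ Set.Ioc (-π) π) (hQk : ∀ k : TorusSite d L, dualVec k ≠ Q) :
    braggWeight μ ![Q] = 0 := by
  set w' : TorusSite d L → ℝ≥0 := fun k => ⟨w k, hw k⟩ with hw'
  have hww : (fun k => (w' k : ℝ)) = w := funext fun k => rfl
  have hμ' : ∀ r : Fin d → ℤ, ∫ ξ, exp ((∑ i, (r i : ℝ) * ξ i : ℝ) * I) ∂μ
      = trigPoly (patternVec d L) (fun l => w' ((Fintype.equivFin (TorusSite d L)).symm l)) r := fun r => by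
    rw [hμ r, ← dualSeries_eq_trigPoly, hww]
  exact braggWeight_eq_zero_of_represents_trigPoly μ hμ' patternVec_mem_Ioc hQ fun l => hQk _

/-! ### §2. Lattice symmetries move from the argument to the weights (general `d`) -/

/-- Characters under a coordinate permutation of the lattice argument. -/
theorem torusChar_toTorus_comp_perm (k : TorusSite d L) (r : Fin d → ℤ) (p : Equiv.Perm (Fin d)) :
    torusChar k (toTorus L (r ∘ p)) = torusChar (k ∘ p.symm) (toTorus L r) := by
  unfold torusChar toTorus
  exact Fintype.prod_equiv p _ _ fun i => by simp

/-- Characters under the reflection of one lattice coordinate. -/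
theorem torusChar_toTorus_update_neg (k : TorusSite d L) (r : Fin d → ℤ) (i : Fin d) :
    torusChar k (toTorus L (Function.update r i (-r i)))
      = torusChar (Function.update k i (-k i)) (toTorus L r) := by
  unfold torusChar toTorus
  refine Finset.prod_congr rfl fun j _ => ?_
  by_cases h : j = i
  · subst h
    simp only [Function.update_self, Int.cast_neg, mul_neg, neg_mul]
  · simp only [Function.update_of_ne h]

/-- The coordinate-reflection involution of the torus. -/
def negAt (i : Fin d) : TorusSite d L ≃ TorusSite d L where
  toFun k := Function.update k i (-k i)
  invFun k := Function.update k i (-k i)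
  left_inv k := by
    funext j
    by_cases h : j = i
    · subst h; simp
    · simp [Function.update_of_ne h]
  right_inv k := by
    funext j
    by_cases h : j = i
    · subst h; simp
    · simp [Function.update_of_ne h]

/-- The coordinate-permutation equivalence of the torus (`k ↦ k ∘ p⁻¹`). -/
def permCoords (p : Equiv.Perm (Fin d)) : TorusSite d L ≃ TorusSite d L where
  toFun k := k ∘ p.symm
  invFun k := k ∘ p
  left_inv k := by funext j; simp
  right_inv k := by funext j; simp

/-- **Permuting lattice coordinates permutes the weights**: `dualSeries w (r ∘ p) = dualSeries (w ∘ (· ∘ p)) r`. -/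
theorem dualSeries_comp_perm (w : TorusSite d L → ℝ) (p : Equiv.Perm (Fin d)) (r : Fin d → ℤ) :
    dualSeries w (r ∘ p) = dualSeries (fun k => w (k ∘ p)) r := by
  unfold dualSeries
  simp_rw [torusChar_toTorus_comp_perm]
  refine Fintype.sum_equiv (permCoords p) _ _ fun k => ?_
  have hk : ((permCoords (L := L) p) k) ∘ p = k := by
    funext j; simp [permCoords]
  rw [hk]
  rfl

/-- **Reflecting a lattice coordinate reflects the weights**:
`dualSeries w (update r i (−r i)) = dualSeries (w ∘ update · i (−· i)) r`. -/
theorem dualSeries_update_neg (w : TorusSite d L → ℝ) (i : Fin d) (r : Fin d → ℤ) :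
    dualSeries w (Function.update r i (-r i)) = dualSeries (fun k => w (Function.update k i (-k i))) r := by
  unfold dualSeries
  simp_rw [torusChar_toTorus_update_neg]
  refine Fintype.sum_equiv (negAt i) _ _ fun k => ?_
  have hk : Function.update ((negAt (L := L) i) k) i (-((negAt (L := L) i) k) i) = k :=
    (negAt (L := L) i).left_inv k
  rw [hk]
  rfl

/-! ### §3. `d = 2`: the eight maps of D₄ and the orbit mean -/

section TwoDim

/-- The sum of `F` over the eight signed coordinate maps of the square lattice (D₄), written out: identity,
`(−v₁, v₀)`, `(−v₀, −v₁)`, `(v₁, −v₀)`, `(v₀, −v₁)`, `(−v₁, −v₀)`, `(−v₀, v₁)`, `(v₁, v₀)` — the list of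
`BraggWeightAtomic.orbitMean_stripeX_trigPoly` and `Transport/D4VecAction.lean` §1. -/
def sum8 {α M : Type*} [Neg α] [AddCommMonoid M] (F : (Fin 2 → α) → M) (v : Fin 2 → α) : M :=
  F ![v 0, v 1] + F ![-v 1, v 0] + F ![-v 0, -v 1] + F ![v 1, -v 0]
    + F ![v 0, -v 1] + F ![-v 1, -v 0] + F ![-v 0, v 1] + F ![v 1, v 0]

/-- The eight maps are the words in the generators `swap`, `update · 0 (−·)`, `update · 1 (−·)`. -/
theorem sum8_eq {α M : Type*} [InvolutiveNeg α] [AddCommMonoid M] (F : (Fin 2 → α) → M) (v : Fin 2 → α) :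
    sum8 F v = F v + F (Function.update v 0 (-v 0)) + F (Function.update v 1 (-v 1))
      + F (Function.update (Function.update v 0 (-v 0)) 1 (-(Function.update v 0 (-v 0)) 1))
      + F (v ∘ ⇑(Equiv.swap (0 : Fin 2) 1))
      + F (Function.update (v ∘ ⇑(Equiv.swap (0 : Fin 2) 1)) 0 (-(v ∘ ⇑(Equiv.swap (0 : Fin 2) 1)) 0))
      + F (Function.update (v ∘ ⇑(Equiv.swap (0 : Fin 2) 1)) 1 (-(v ∘ ⇑(Equiv.swap (0 : Fin 2) 1)) 1))
      + F (Function.update (Function.update (v ∘ ⇑(Equiv.swap (0 : Fin 2) 1)) 0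
            (-(v ∘ ⇑(Equiv.swap (0 : Fin 2) 1)) 0)) 1
          (-(Function.update (v ∘ ⇑(Equiv.swap (0 : Fin 2) 1)) 0 (-(v ∘ ⇑(Equiv.swap (0 : Fin 2) 1)) 0)) 1)) := by
  have e1 : (![v 0, v 1] : Fin 2 → α) = v := by funext i; fin_cases i <;> simp
  have e2 : Function.update v 0 (-v 0) = ![-v 0, v 1] := by funext i; fin_cases i <;> simp
  have e3 : Function.update v 1 (-v 1) = ![v 0, -v 1] := by funext i; fin_cases i <;> simp
  have e4 : Function.update (Function.update v 0 (-v 0)) 1 (-(Function.update v 0 (-v 0)) 1)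
      = ![-v 0, -v 1] := by funext i; fin_cases i <;> simp
  have e5 : (v ∘ ⇑(Equiv.swap (0 : Fin 2) 1)) = ![v 1, v 0] := by
    funext i; fin_cases i <;> simp [Equiv.swap_apply_left, Equiv.swap_apply_right]
  have e6 : Function.update (![v 1, v 0] : Fin 2 → α) 0 (-(![v 1, v 0] : Fin 2 → α) 0) = ![-v 1, v 0] := by
    funext i; fin_cases i <;> simp
  have e7 : Function.update (![v 1, v 0] : Fin 2 → α) 1 (-(![v 1, v 0] : Fin 2 → α) 1) = ![v 1, -v 0] := by
    funext i; fin_cases i <;> simp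
  have e8 : Function.update (Function.update (![v 1, v 0] : Fin 2 → α) 0 (-(![v 1, v 0] : Fin 2 → α) 0)) 1
      (-(Function.update (![v 1, v 0] : Fin 2 → α) 0 (-(![v 1, v 0] : Fin 2 → α) 0)) 1) = ![-v 1, -v 0] := by
    funext i; fin_cases i <;> simp
  rw [sum8, e4, e2, e3, e5, e8, e6, e7, e1]
  abel

/-- The D₄ ORBIT MEAN of a function on `ℤ²`: `C̄(v) = 8⁻¹ Σ_{g ∈ D₄} C(g v)`. -/
def orbitMean8 (C : (Fin 2 → ℤ) → ℂ) (v : Fin 2 → ℤ) : ℂ := (8 : ℂ)⁻¹ * sum8 C v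

/-- The orbit-averaged weights on the dual grid: `w̄(k) = 8⁻¹ Σ_{g ∈ D₄} w(g k)`. -/
def orbitWt8 (w : TorusSite 2 L → ℝ) (k : TorusSite 2 L) : ℝ := (8 : ℝ)⁻¹ * sum8 w k

omit [NeZero L] in
/-- Orbit-averaged nonnegative weights are nonnegative. -/
theorem orbitWt8_nonneg {w : TorusSite 2 L → ℝ} (hw : ∀ k, 0 ≤ w k) (k : TorusSite 2 L) : 0 ≤ orbitWt8 w k := by
  unfold orbitWt8 sum8
  have h1 := hw ![k 0, k 1]; have h2 := hw ![-k 1, k 0]; have h3 := hw ![-k 0, -k 1]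
  have h4 := hw ![k 1, -k 0]; have h5 := hw ![k 0, -k 1]; have h6 := hw ![-k 1, -k 0]
  have h7 := hw ![-k 0, k 1]; have h8 := hw ![k 1, k 0]
  refine mul_nonneg (by norm_num) ?_
  linarith

/-- **The orbit mean of a dual series is the dual series of the orbit-averaged weights.** -/
theorem orbitMean8_dualSeries (w : TorusSite 2 L → ℝ) (v : Fin 2 → ℤ) :
    orbitMean8 (dualSeries w) v = dualSeries (orbitWt8 w) v := by
  rw [orbitMean8, sum8_eq]
  simp only [dualSeries_update_neg, dualSeries_comp_perm]
  unfold dualSeries orbitWt8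
  simp_rw [sum8_eq]
  push_cast
  simp only [Finset.mul_sum, ← Finset.sum_add_distrib]
  refine Finset.sum_congr rfl fun k _ => ?_
  ring

/-- **Bragg weights of the orbit mean of a pattern autocorrelation.**  For every `L`-periodic pattern `f` on `ℤ²`
and every finite measure representing the D₄ orbit mean of its autocorrelation, the Bragg weight at the dual-grid
wavevector `dualVec k` is the orbit average `8⁻¹ Σ_{g ∈ D₄} |f̂(g k)|²`. -/
theorem braggWeight_of_represents_orbitMean (f : TorusSite 2 L → ℂ)
    (μ : Measure (EuclideanSpace ℝ (Fin 2))) [IsFiniteMeasure μ]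
    (hμ : ∀ r : Fin 2 → ℤ, ∫ ξ, exp ((∑ i, (r i : ℝ) * ξ i : ℝ) * I) ∂μ
      = orbitMean8 (fun v => autocorr f (toTorus L v)) r)
    (k : TorusSite 2 L) :
    braggWeight μ ![dualVec k] = orbitWt8 (fun k => ‖fourierCoeff f k‖ ^ 2) k := by
  have hC : (fun v => autocorr f (toTorus L v)) = dualSeries (fun k => ‖fourierCoeff f k‖ ^ 2) :=
    funext (autocorr_eq_dualSeries f)
  have hμ' : ∀ r : Fin 2 → ℤ, ∫ ξ, exp ((∑ i, (r i : ℝ) * ξ i : ℝ) * I) ∂μ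
      = dualSeries (orbitWt8 fun k => ‖fourierCoeff f k‖ ^ 2) r := fun r => by
    rw [hμ r, hC, orbitMean8_dualSeries]
  exact braggWeight_of_represents_dualSeries _ (orbitWt8_nonneg fun k => sq_nonneg _) μ hμ' k

/-! ### §4. Unidirectional patterns: Fourier support on `k₁ = 0`, real patterns, the charge arm -/

/-- Translating the pattern by `e₁` multiplies `torusFourier` by a character value: if `f (x + e₁) = c · f x`
(`c = 1`: `y`-independent pattern; `c = −1`: antiphase in `y`) then `(1 − c · conj e(k₁)) · F̂(k) = 0`. -/
theorem torusFourier_mul_of_shift_covariant (f : TorusSite 2 L → ℂ) (c : ℂ)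
    (hf : ∀ x, f (x + Pi.single 1 1) = c * f x) (k : TorusSite 2 L) :
    (1 - c * conj (stdAddChar (k 1) : ℂ)) * torusFourier f k = 0 := by
  have ht : torusChar k (Pi.single 1 1 : TorusSite 2 L) = stdAddChar (k 1) := by
    unfold torusChar
    rw [Fin.prod_univ_two]
    simp
  have hshift : torusFourier f k = c * conj (stdAddChar (k 1) : ℂ) * torusFourier f k := by
    rw [torusFourier_eq_sum_torusChar]
    conv_lhs => rw [← Equiv.sum_comp (Equiv.addRight (Pi.single 1 1 : TorusSite 2 L))]
    simp only [Equiv.coe_addRight, hf, torusChar_add_right, map_mul, ht]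
    rw [Finset.mul_sum]
    exact Finset.sum_congr rfl fun x _ => by ring
  linear_combination hshift

/-- Hence `f̂(k) = 0` at every `k` with `c · conj e(k₁) ≠ 1`. -/
theorem fourierCoeff_eq_zero_of_shift_covariant (f : TorusSite 2 L → ℂ) (c : ℂ)
    (hf : ∀ x, f (x + Pi.single 1 1) = c * f x) {k : TorusSite 2 L}
    (hk : c * conj (stdAddChar (k 1) : ℂ) ≠ 1) : fourierCoeff f k = 0 := by
  have h := torusFourier_mul_of_shift_covariant f c hf k
  have : torusFourier f k = 0 := (mul_eq_zero.mp h).resolve_left (sub_ne_zero.mpr (Ne.symm hk))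
  rw [fourierCoeff, this, mul_zero]

/-- A `y`-INDEPENDENT pattern (`f (x + e₁) = f x`, e.g. `f x = g (x 0)`) has Fourier coefficients supported on
`k₁ = 0`. -/
theorem fourierCoeff_eq_zero_of_shift_invariant (f : TorusSite 2 L → ℂ)
    (hf : ∀ x, f (x + Pi.single 1 1) = f x) {k : TorusSite 2 L} (hk : k 1 ≠ 0) :
    fourierCoeff f k = 0 := by
  refine fourierCoeff_eq_zero_of_shift_covariant f 1 (fun x => by rw [hf x, one_mul]) fun h1 => hk ?_
  rw [one_mul] at h1
  have h2 : (stdAddChar (k 1) : ℂ) = 1 := by simpa using congrArg conj h1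
  have h3 : (stdAddChar (k 1) : ℂ) = stdAddChar (0 : ZMod L) := by rw [h2, AddChar.map_zero_eq_one]
  exact ZMod.injective_stdAddChar h3

/-- Period `16`: `e(8) = −1`. -/
theorem stdAddChar_sixteen_eight : (stdAddChar (8 : ZMod 16) : ℂ) = -1 := by
  rw [show (8 : ZMod 16) = ((8 : ℤ) : ZMod 16) by norm_cast, ZMod.stdAddChar_coe]
  push_cast
  rw [show 2 * (π : ℂ) * I * 8 / 16 = π * I by ring, Complex.exp_pi_mul_I]

/-- A pattern ANTIPHASE in `y` with period 16 (`f (x + e₁) = −f x`, e.g. an `x`-stripe of staggered moments)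
has Fourier coefficients supported on `k₁ = 8` (i.e. `q_y = π`). -/
theorem fourierCoeff_eq_zero_of_antiphase (f : TorusSite 2 16 → ℂ)
    (hf : ∀ x, f (x + Pi.single 1 1) = -f x) {k : TorusSite 2 16} (hk : k 1 ≠ 8) :
    fourierCoeff f k = 0 := by
  refine fourierCoeff_eq_zero_of_shift_covariant f (-1) (fun x => by rw [hf x, neg_one_mul]) fun h1 => hk ?_
  have h2 : (stdAddChar (k 1) : ℂ) = -1 := by
    have := congrArg conj h1
    simp only [map_neg, map_one, Complex.conj_conj, neg_one_mul] at this
    linear_combination -this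
  rw [← stdAddChar_sixteen_eight] at h2
  exact ZMod.injective_stdAddChar h2

omit [NeZero L] in
/-- `f x = g (x 0)` is `y`-independent. -/
theorem shift_invariant_of_comp_zero (g : ZMod L → ℂ) (x : TorusSite 2 L) :
    (fun x : TorusSite 2 L => g (x 0)) (x + Pi.single 1 1) = (fun x : TorusSite 2 L => g (x 0)) x := by
  simp

/-- **Real patterns have even Fourier modulus**: `|f̂(−k)| = |f̂(k)|`. -/
theorem norm_fourierCoeff_neg (f : TorusSite d L → ℂ) (hf : ∀ x, conj (f x) = f x) (k : TorusSite d L) :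
    ‖fourierCoeff f (-k)‖ = ‖fourierCoeff f k‖ := by
  have hc : conj (((L : ℂ) ^ d)⁻¹) = ((L : ℂ) ^ d)⁻¹ := by
    rw [map_inv₀, map_pow, Complex.conj_natCast]
  have h : fourierCoeff f (-k) = conj (fourierCoeff f k) := by
    rw [fourierCoeff_eq_sum, fourierCoeff_eq_sum, map_mul, hc, map_sum]
    congr 1
    refine Finset.sum_congr rfl fun x _ => ?_
    rw [map_mul, hf x, Complex.conj_conj, torusChar_comm (-k) x, torusChar_neg_right, Complex.conj_conj,
      torusChar_comm x k]
  rw [h, Complex.norm_conj]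

/-- **Charge arm, unidirectional real stripe of period 8.**  For every real `y`-independent 8-periodic pattern
and every finite measure representing the D₄ ORBIT MEAN of its autocorrelation, the Bragg weight on the arm
`Q_c = (π/4, 0)` is HALF the squared first harmonic: `|f̂(1, 0)|² / 2`. -/
theorem braggWeight_chargeArm_of_represents_orbitMean_xStripe (f : TorusSite 2 8 → ℂ)
    (hreal : ∀ x, conj (f x) = f x) (hshift : ∀ x, f (x + Pi.single 1 1) = f x)
    (μ : Measure (EuclideanSpace ℝ (Fin 2))) [IsFiniteMeasure μ]
    (hμ : ∀ r : Fin 2 → ℤ, ∫ ξ, exp ((∑ i, (r i : ℝ) * ξ i : ℝ) * I) ∂μ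
      = orbitMean8 (fun v => autocorr f (toTorus 8 v)) r) :
    braggWeight μ ![![π / 4, 0]] = ‖fourierCoeff f ![1, 0]‖ ^ 2 / 2 := by
  rw [← dualVec_eight_one_zero, braggWeight_of_represents_orbitMean f μ hμ]
  have h01 : fourierCoeff f ![0, 1] = 0 :=
    fourierCoeff_eq_zero_of_shift_invariant f hshift (by simp; decide)
  have h0m1 : fourierCoeff f ![0, -1] = 0 :=
    fourierCoeff_eq_zero_of_shift_invariant f hshift (by simp; decide)
  have hm10 : ‖fourierCoeff f ![-1, 0]‖ = ‖fourierCoeff f ![1, 0]‖ := by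
    have : (![-1, 0] : TorusSite 2 8) = -![1, 0] := by funext i; fin_cases i <;> simp
    rw [this, norm_fourierCoeff_neg f hreal]
  unfold orbitWt8 sum8
  simp only [Matrix.cons_val_zero, Matrix.cons_val_one, Matrix.cons_val_fin_one, neg_zero, h01, h0m1, hm10,
    norm_zero]
  ring

/-- **Spin arm, antiphase real stripe of period 16.**  For every real pattern with `f (x + e₁) = −f x`
(staggered in `y`; e.g. `f (x₀, x₁) = (−1)^{x₁} m(x₀)` with a 16-periodic moment profile `m`) and every finite
measure representing the D₄ orbit mean of its autocorrelation, the Bragg weight on the arm `Q_s = (7π/8, π)` is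
`|f̂(7, 8)|² / 2`. -/
theorem braggWeight_spinArm_of_represents_orbitMean_antiphaseStripe (f : TorusSite 2 16 → ℂ)
    (hreal : ∀ x, conj (f x) = f x) (hanti : ∀ x, f (x + Pi.single 1 1) = -f x)
    (μ : Measure (EuclideanSpace ℝ (Fin 2))) [IsFiniteMeasure μ]
    (hμ : ∀ r : Fin 2 → ℤ, ∫ ξ, exp ((∑ i, (r i : ℝ) * ξ i : ℝ) * I) ∂μ
      = orbitMean8 (fun v => autocorr f (toTorus 16 v)) r) :
    braggWeight μ ![![7 * π / 8, π]] = ‖fourierCoeff f ![7, 8]‖ ^ 2 / 2 := by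
  rw [← dualVec_sixteen_seven_eight, braggWeight_of_represents_orbitMean f μ hμ]
  have h8 : (-8 : ZMod 16) = 8 := by decide
  have h87 : fourierCoeff f ![8, 7] = 0 := fourierCoeff_eq_zero_of_antiphase f hanti (by simp; decide)
  have h8m7 : fourierCoeff f ![8, -7] = 0 := fourierCoeff_eq_zero_of_antiphase f hanti (by simp; decide)
  have hm78 : ‖fourierCoeff f ![-7, 8]‖ = ‖fourierCoeff f ![7, 8]‖ := by
    have : (![-7, 8] : TorusSite 2 16) = -![7, 8] := by funext i; fin_cases i <;> simp [h8]
    rw [this, norm_fourierCoeff_neg f hreal]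
  unfold orbitWt8 sum8
  simp only [Matrix.cons_val_zero, Matrix.cons_val_one, Matrix.cons_val_fin_one, h8, h87, h8m7, hm78, norm_zero]
  ring

end TwoDim

end Summit.Ventures.CertifiedManyBodySolver.Observables
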